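import Literature.RingTheory.SimpleModule.SemisimpleBaseChange
import Mathlib.RingTheory.Flat.Basic
import Mathlib.Algebra.CharP.Algebra
import HarnessLib

/-!
# Descent of semisimplicity along a field extension (characteristic zero): `L ⊗_k S` semisimple ⇒ `S` semisimple

Topic `RingTheory/SimpleModule`; namespace `Literature.RingTheory.SimpleModule`.  THEOREMS ONLY, Mathlib + ★
`SemisimpleBaseChange` (no definition, no named fact, no instance, no `sorry`).  The CONVERSE of ★
`isSemisimpleRing_baseChange` ([Pierce1982] §10.6 Corollary / §10.7 Corollary b: over a perfect field a finite-dimensional algebra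
`A` is separable iff `A^E` is semisimple for every, equivalently one, field `E ⊇ F`; here the «one `E` suffices, downwards»
half in characteristic `0`).  Cell hodgecm-mathlib, d6 line, next-run DEF DH2 (A-p09 (g13) census `CENSUS-DH1-DH2.A-p09g13.md`
§(G2)): the image of the Hecke algebra in `End⁰_F(A_K)` is a finite-dimensional `ℚ`-algebra whose complexification is shown
semisimple on `ℂ ⊗ H¹_B(A_K)` (door (β), ★ `SemisimpleOfFaithfulModule`); this file brings semisimplicity back down to `ℚ`.

PROOF (trace form, as in ★ `SemisimpleBaseChange`): by ★ `isSemisimpleRing_of_forall_trace_lmul_mul_eq_zero` it suffices that the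
trace form of `S` has zero left radical.  If `Tr_k(L_{xy}) = 0` for all `y ∈ S`, then `Tr_L(L_{(1⊗x)z}) = 0` for all `z ∈ L ⊗_k S`
(`z ↦ Tr_L(L_{(1⊗x)z})` is `L`-linear and on `1 ⊗ y` equals the image of `Tr_k(L_{xy})`, ★ `trace_lmul_one_tmul_mul_one_tmul`), so
`1 ⊗ x = 0` by non-degeneracy of the trace form of the SEMISIMPLE `L`-algebra `L ⊗_k S` (★ `eq_zero_of_forall_trace_lmul_mul_eq_zero`,
characteristic `0`), and `x = 0` because `S → L ⊗_k S` is injective (Mathlib `Algebra.TensorProduct.includeRight_injective`, `S` flat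
over the field `k`).

CONTENT: `trace_lmul_one_tmul_mul_eq_zero_of_forall` (the `L`-linear extension step), **`isSemisimpleRing_of_isSemisimpleRing_baseChange`**,
and the `iff` packaging `isSemisimpleRing_baseChange_iff`.  HC_CM is proved only modulo the 7 printed citations until rung 0 closes;
nothing here moves a book.

## References
* [Pierce1982] R. S. Pierce, *Associative Algebras*, GTM 88, Springer (1982), §10.6 Corollary (p. 189), §10.7 Corollary b (p. 191).
* [Lam2001FirstCourse] T. Y. Lam, *A First Course in Noncommutative Rings*, 2nd ed., GTM 131 (2001), §5 (separable algebras; the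
  trace-form criterion in characteristic `0`).
-/

set_option autoImplicit false

open scoped TensorProduct

namespace Literature.RingTheory.SimpleModule

variable (k : Type*) [Field k] (S : Type*) [Ring S] [Algebra k S] (L : Type*) [Field L] [Algebra k L]

/-- If `x ∈ S` pairs to zero with all of `S` under the trace form `Tr_k(L_{xy})`, then `1 ⊗ x` pairs to zero with ALL of `L ⊗_k S`
under `Tr_L(L_{(1⊗x)z})` — the latter is `L`-linear in `z` and equals the image of the former on `z = 1 ⊗ y`.
[cite: Pierce1982, §10.6 Corollary (p. 189)] -/
theorem trace_lmul_one_tmul_mul_eq_zero_of_forall [Module.Finite k S] {x : S}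
    (hx : ∀ y : S, LinearMap.trace k S (Algebra.lmul k S (x * y)) = 0) (z : L ⊗[k] S) :
    LinearMap.trace L (L ⊗[k] S) (Algebra.lmul L (L ⊗[k] S) (((1 : L) ⊗ₜ[k] x) * z)) = 0 := by
  induction z using TensorProduct.induction_on with
  | zero => rw [mul_zero, map_zero, map_zero]
  | tmul l t =>
    have hlt : (l ⊗ₜ[k] t : L ⊗[k] S) = l • ((1 : L) ⊗ₜ[k] t) := by
      rw [TensorProduct.smul_tmul', smul_eq_mul, mul_one]
    rw [hlt, mul_smul_comm, map_smul, map_smul, trace_lmul_one_tmul_mul_one_tmul, hx t, map_zero, smul_zero]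
  | add a b ha hb => rw [mul_add, map_add, map_add, ha, hb, add_zero]

/-- **Descent of semisimplicity (characteristic `0`)**: if `L ⊗_k S` is a semisimple ring for a finite-dimensional algebra `S`
over a field `k` of characteristic `0` and a field extension `L/k`, then `S` is semisimple.
[cite: Pierce1982, §10.6 Corollary (p. 189) and §10.7 Corollary b (p. 191)] -/
theorem isSemisimpleRing_of_isSemisimpleRing_baseChange [CharZero k] [Module.Finite k S]
    [IsSemisimpleRing (L ⊗[k] S)] : IsSemisimpleRing S := by
  haveI : CharZero L := charZero_of_injective_algebraMap (algebraMap k L).injective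
  refine isSemisimpleRing_of_forall_trace_lmul_mul_eq_zero k fun x hx => ?_
  have h0 : ((1 : L) ⊗ₜ[k] x : L ⊗[k] S) = 0 :=
    eq_zero_of_forall_trace_lmul_mul_eq_zero L (trace_lmul_one_tmul_mul_eq_zero_of_forall k S L hx)
  have hinj : Function.Injective (Algebra.TensorProduct.includeRight : S →ₐ[k] L ⊗[k] S) :=
    Algebra.TensorProduct.includeRight_injective (algebraMap k L).injective
  exact hinj (by rw [Algebra.TensorProduct.includeRight_apply, h0, map_zero])

/-- **Semisimplicity is invariant under base change along a field extension in characteristic `0`** (both directions: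
★ `isSemisimpleRing_baseChange` and `isSemisimpleRing_of_isSemisimpleRing_baseChange`).
[cite: Pierce1982, §10.6 Corollary (p. 189) and §10.7 Corollary b (p. 191)] -/
theorem isSemisimpleRing_baseChange_iff [CharZero k] [Module.Finite k S] :
    IsSemisimpleRing (L ⊗[k] S) ↔ IsSemisimpleRing S :=
  ⟨fun _ => isSemisimpleRing_of_isSemisimpleRing_baseChange k S L, fun _ => isSemisimpleRing_baseChange k S L⟩

end Literature.RingTheory.SimpleModule
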